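import Summits.QuantumFields.YangMills.Theorems.BalabanLadderUVSeamRecResponseMomentsPinning
import HarnessLib

/-!
# Crux `UVSeamRec` (stmt-QuantumFields-20043), ceilings `MomentBounds6`: the KERNEL FORM — the registered ceiling is a statement
# about the joint law of the centred femto RESPONSES only; absolute response moments (AM) are the weakest natural supplier

Helper file (`--supports stmt-QuantumFields-20043`) of the stub-helper seat `ym-20043-seam-s2` (lane S-A, gen 2).  Complement
to `…CeilingsProductMoments.lean` (p542286) and `…ResponseMomentsPinning.lean` (p540020): the hierarchy of measure-side
currencies above the v5(α) ceiling `stub_ceilings : UV → MomentBounds6 SU(2) rF uRec` is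

  (RM) ⇒ (PM) ⇒ (AM) ⇒ `MomentBounds6` ⟺ (signed kernel form),

all on the same guards (odd torus `(ℤ/(2L+1))⁴`, `1 ≤ R`, `R·a β ≤ ℓ`, `4R+8 ≤ L`, cyclic `2R+4`-separation), where with the
centred responses `hᵢ(U) := kerE_{x i−(R+1),2R+3}(plane (q i) (x i))(U) − ⟨plane (q i) (x i)⟩_{2L+1,β}`:

* (signed kernel form) `|⟨∏ᵢ hᵢ⟩_{2L+1,β}| ≤ (C/R⁴)ⁿ` — EQUAL to `MomentBounds6`'s body by g0's collar identity
  (`DefectCollar.integral_prod_sub_mean_eq_integral_prod_collared`, p518354): **`momentBounds6_iff_kernelForm`** (§2);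
* (AM) `⟨∏ᵢ |hᵢ|⟩_{2L+1,β} ≤ (C/R⁴)ⁿ` — one triangle inequality above it: **`momentBounds6_of_absKernelMoments`** (§3);
* (PM)/(RM) — p542286 / p532025.

So every supplier of the E0′ ceilings is a statement about the femto responses `hᵢ` ALONE (functions of the collar links of the
radius-`R+1` cubes), and nothing is lost in passing from plaquette fields to responses.  §1 is the identity for plane
families with arbitrary centring constants (`torusE_prod_plane_sub_eq_torusE_prod_kerE_sub`).

HONEST FRAMING: exact reformulation + one sufficient condition; the ceilings at `β → ∞` are OPEN (E0′); nothing of E0′ is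
proved here; not a gap, not Clay.

References: H.-O. Georgii, *Gibbs Measures and Phase Transitions* (2011) Thm. 4.17 / (4.18) (DLR consistency — via p518354);
E. Seiler, LNP 159 (1982) Ch. 2.
-/

set_option autoImplicit false

noncomputable section

open MeasureTheory Filter Topology Finset
open Literature.Probability.LatticeModels
open Literature.MathematicalPhysics.QuantumFieldTheory (GaugeConfig wilsonMeasure isProbabilityMeasure_wilsonMeasure
  measurable_torusLift LatticeRep)
open Literature.MathematicalPhysics.QuantumLattice
open Summit.QuantumFields.YangMills.Cruxes.UVSeamRec.DefectCollar (integral_prod_sub_mean_eq_integral_prod_collared)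
open Summit.QuantumFields.YangMills.Cruxes.OSLegsFromFemtoAndGap.DlrCollarTransfer
open Summit.QuantumFields.YangMills.Cruxes.UVSeamRec.TemperedResponse (continuous_kerE_plane)

namespace Summit.QuantumFields.YangMills.Cruxes.UVSeamRec.ResponsePinning

variable {G : Type} [Group G] [TopologicalSpace G] [IsTopologicalGroup G] [CompactSpace G]
  [MeasurableSpace G] [BorelSpace G] (r : LatticeRep G)

/-! ## §1 The collar identity for plane families -/

/-- **The collar identity for a separated plane family, any centring constants.**  On the odd torus `(ℤ/(2L+1))⁴` with
`4R+8 ≤ L`, `1 ≤ R`, for sites pairwise cyclically `2R+4`-separated in some coordinate and ANY constants `mᵢ`: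
`⟨∏ᵢ (plane (q i) (x i) − mᵢ)⟩_{2L+1,β} = ⟨∏ᵢ (kerE_{x i−(R+1),2R+3}(plane (q i) (x i)) − mᵢ)⟩_{2L+1,β}` — p518354's identity in
the geometry of the landed collar (`injOn_torusProj_cube`, `torusEdge_ne_cube`, `isCylinder_plane_cube`).
[folklore: Georgii (2011) Thm. 4.17] -/
theorem torusE_prod_plane_sub_eq_torusE_prod_kerE_sub (β : ℝ) {L n : ℕ} (q : Fin n → Fin 4 × Fin 4)
    (x : Fin n → (Fin 4 → ℤ)) {R : ℕ} (hR : 1 ≤ R) (hRL : 4 * R + 8 ≤ L)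
    (hsep : ∀ i j : Fin n, i ≠ j → ∃ k : Fin 4,
      (2 * (R : ℤ) + 4) ≤ |((((x i k - x j k : ℤ) : ZMod (2 * L + 1))).valMinAbs : ℤ)|)
    (m : Fin n → ℝ) :
    torusE G r β L (fun U => ∏ i, (plane G r (q i) (x i) U - m i)) =
      torusE G r β L (fun U => ∏ i, (kerE G r β (fun k => x i k - (R + 1)) (2 * R + 3) U (plane G r (q i) (x i)) - m i)) := by
  haveI : SecondCountableTopology G :=
    (r.continuous.isClosedEmbedding r.injective).isEmbedding.secondCountableTopology
  obtain ⟨CA, hCA⟩ := exists_abs_plane_le r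
  have hinj : ∀ i : Fin n, Set.InjOn (Torus.proj (2 * L + 1))
      (((cubeEdges (fun k => x i k - (R + 1)) (2 * R + 3) ∪ cubeEdges (fun k => x i k - (R + 1)) (2 * R + 3) ∪
          (plaquettesTouching (cubeEdges (fun k => x i k - (R + 1)) (2 * R + 3))).biUnion plaquetteEdges).image
          Prod.fst : Set (Fin 4 → ℤ))) := fun i => injOn_torusProj_cube hRL (x i)
  have hfar : ∀ i j : Fin n, i ≠ j → ∀ e ∈ cubeEdges (fun k => x j k - (R + 1)) (2 * R + 3) ∪
      (plaquettesTouching (cubeEdges (fun k => x j k - (R + 1)) (2 * R + 3))).biUnion plaquetteEdges,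
      ∀ e' ∈ cubeEdges (fun k => x i k - (R + 1)) (2 * R + 3),
      torusEdge (2 * L + 1) e ≠ torusEdge (2 * L + 1) e' :=
    fun i j hij e he e' he' => torusEdge_ne_cube (hsep i j hij) he he'
  have key := integral_prod_sub_mean_eq_integral_prod_collared (d := 4) r.ρ r.continuous β (L := 2 * L + 1) (n := n)
    (fun i => cubeEdges (fun k => x i k - (R + 1)) (2 * R + 3))
    (fun i => cubeEdges (fun k => x i k - (R + 1)) (2 * R + 3))
    (fun i => plane G r (q i) (x i)) (fun i => continuous_plane r (q i) (x i)) (fun i U => hCA (q i) (x i) U)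
    (fun i => isCylinder_plane_cube r hR (q i) (x i)) hinj hfar m
  unfold torusE kerE
  exact key

/-! ## §2 `MomentBounds6` in kernel form (exact) -/

/-- **`MomentBounds6 G r a` ⟺ the signed kernel form.**  The registered ceiling holds iff, with the SAME constants and guards,
the signed mixed moments of the centred femto responses `hᵢ = kerE_{cube i}(plane_i) − ⟨plane_i⟩_{2L+1,β}` obey
`|⟨∏ᵢ hᵢ⟩_{2L+1,β}| ≤ (C/R⁴)ⁿ` (§1 under the quantifiers). [folklore: Georgii (2011) Thm. 4.17] -/
theorem momentBounds6_iff_kernelForm (a : ℝ → ℝ) :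
    MomentBounds6 G r a ↔
      ∃ (C β₄ ℓ₄ : ℝ), 0 < ℓ₄ ∧ 0 ≤ C ∧ ∀ β : ℝ, β₄ ≤ β →
        ∀ (L n : ℕ) (q : Fin n → Fin 4 × Fin 4) (x : Fin n → (Fin 4 → ℤ)) (R : ℕ), (∀ i, (q i).1 < (q i).2) →
          1 ≤ R → (R : ℝ) * a β ≤ ℓ₄ → 4 * R + 8 ≤ L →
          (∀ i j : Fin n, i ≠ j → ∃ k : Fin 4,
            (2 * (R : ℤ) + 4) ≤ |((((x i k - x j k : ℤ) : ZMod (2 * L + 1))).valMinAbs : ℤ)|) →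
          |torusE G r β L (fun U => ∏ i,
              (kerE G r β (fun k => x i k - (R + 1)) (2 * R + 3) U (plane G r (q i) (x i)) -
                torusE G r β L (plane G r (q i) (x i))))| ≤ (C / (R : ℝ) ^ 4) ^ n := by
  constructor
  · rintro ⟨C, β₄, ℓ₄, hℓ₄, hC, H⟩
    refine ⟨C, β₄, ℓ₄, hℓ₄, hC, fun β hβ L n q x R hq hR hRa hRL hsep => ?_⟩
    rw [← torusE_prod_plane_sub_eq_torusE_prod_kerE_sub r β q x hR hRL hsep]
    exact H β hβ L n q x R hq hR hRa hRL hsep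
  · rintro ⟨C, β₄, ℓ₄, hℓ₄, hC, H⟩
    refine ⟨C, β₄, ℓ₄, hℓ₄, hC, fun β hβ L n q x R hq hR hRa hRL hsep => ?_⟩
    rw [torusE_prod_plane_sub_eq_torusE_prod_kerE_sub r β q x hR hRL hsep]
    exact H β hβ L n q x R hq hR hRa hRL hsep

/-! ## §3 Absolute response moments (AM) suffice -/

/-- **(AM) ⇒ `MomentBounds6 G r a`.**  If for `β ≥ β₄`, on every odd torus with `4R+8 ≤ L`, `1 ≤ R`, `R·a β ≤ ℓ₄`, for
cyclically separated families, the ABSOLUTE mixed moments of the centred femto responses obey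
`⟨∏ᵢ |kerE_{cube i}(plane_i) − ⟨plane_i⟩|⟩_{2L+1,β} ≤ (C/R⁴)ⁿ`, then `MomentBounds6 G r a` with the same constants
(`|∫∏ hᵢ| ≤ ∫∏|hᵢ|` after §1).  (AM) sits one triangle inequality above the ceiling and below (PM) (p542286) and (RM)
(p532025); at `n = 1` it is the averaged one-point law. [folklore: Georgii (2011) Thm. 4.17] -/
theorem momentBounds6_of_absKernelMoments (a : ℝ → ℝ) {C β₄ ℓ₄ : ℝ} (hℓ₄ : 0 < ℓ₄) (hC : 0 ≤ C)
    (hAM : ∀ β : ℝ, β₄ ≤ β →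
      ∀ (L n : ℕ) (q : Fin n → Fin 4 × Fin 4) (x : Fin n → (Fin 4 → ℤ)) (R : ℕ), (∀ i, (q i).1 < (q i).2) →
        1 ≤ R → (R : ℝ) * a β ≤ ℓ₄ → 4 * R + 8 ≤ L →
        (∀ i j : Fin n, i ≠ j → ∃ k : Fin 4,
          (2 * (R : ℤ) + 4) ≤ |((((x i k - x j k : ℤ) : ZMod (2 * L + 1))).valMinAbs : ℤ)|) →
        torusE G r β L (fun U => ∏ i,
            |kerE G r β (fun k => x i k - (R + 1)) (2 * R + 3) U (plane G r (q i) (x i)) -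
              torusE G r β L (plane G r (q i) (x i))|) ≤ (C / (R : ℝ) ^ 4) ^ n) :
    MomentBounds6 G r a := by
  refine (momentBounds6_iff_kernelForm r a).2 ⟨C, β₄, ℓ₄, hℓ₄, hC, fun β hβ L n q x R hq hR hRa hRL hsep => ?_⟩
  refine le_trans ?_ (hAM β hβ L n q x R hq hR hRa hRL hsep)
  have e : (fun U : LGConfig 4 G => ∏ i,
      |kerE G r β (fun k => x i k - (R + 1)) (2 * R + 3) U (plane G r (q i) (x i)) -
        torusE G r β L (plane G r (q i) (x i))|) =
      fun U => |∏ i, (kerE G r β (fun k => x i k - (R + 1)) (2 * R + 3) U (plane G r (q i) (x i)) -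
        torusE G r β L (plane G r (q i) (x i)))| := funext fun U => (Finset.abs_prod _ _).symm
  rw [e]
  unfold torusE
  exact abs_integral_le_integral_abs

end Summit.QuantumFields.YangMills.Cruxes.UVSeamRec.ResponsePinning

end
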